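import Summits.FinalStateConjecture.FinalStateConjecture.Theorems.PhotonSphereChannelsBlindnessWaveSolution
import Summits.FinalStateConjecture.FinalStateConjecture.Theorems.PhotonSphereChannelsEnergyInequalities
import Literature.Geometry.Lorentzian.ReggeWheelerRestPacket

/-!
# Route PhotonSphereChannels · `UniformPhotonSphereChannels` (K1) — the cut-off profile of the rest
# packet and two bookkeeping lemmas

Support file for item stmt-FinalStateConjecture-10045 (registered sub-goal `stub_restPacket_cutoff`
of prover seat 1): the concrete `C²` cut-off `χ(u) = expNegInvGlue(u − 13/20) expNegInvGlue(17/20 − u)`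
of the Rindler rest packet (supported in `(13/20, 17/20)`, positive there, bounded with bounded
second derivative — `exists_cutoff`), the choice of an angular number in a multiplicative window
(`exists_nat_window`: `B ≥ 2 ⇒ ∃ ℓ ≥ 1, B/3 ≤ ℓ(ℓ+1) ≤ B`), and the conversion between the
`ℝ≥0∞`-valued near velocity mass `∫⁻_{x<x_e} g²` and `∫_α^β g²` for a continuous datum vanishing off
`[α, β]` (`lintegral_sq_Iio`).  No definitions are introduced.
-/

noncomputable section

open Set Filter MeasureTheory intervalIntegral Topology Function

namespace Summit.FinalStateConjecture.FinalStateConjecture.Theorems.RestPacket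

open Literature.Geometry.Lorentzian.ReggeWheeler
open scoped ENNReal

/-! ### The cut-off profile -/

/-- A `C²` (indeed smooth) cut-off supported in `(13/20, 17/20)`, positive there, with bounded values
and bounded second derivative. -/
theorem exists_cutoff :
    ∃ χ : ℝ → ℝ, ContDiff ℝ 2 χ ∧ (∀ u, u ≤ 13 / 20 ∨ 17 / 20 ≤ u → χ u = 0) ∧
      (∀ u ∈ Ioo (13 / 20 : ℝ) (17 / 20), 0 < χ u) ∧
      (∃ B₀, ∀ u, |χ u| ≤ B₀) ∧ (∃ B₂, ∀ u, |deriv (deriv χ) u| ≤ B₂) := by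
  set a : ℝ := 13 / 20 with ha
  set b : ℝ := 17 / 20 with hb
  let χ : ℝ → ℝ := fun u => expNegInvGlue (u - a) * expNegInvGlue (b - u)
  have hχ_def : ∀ u, χ u = expNegInvGlue (u - a) * expNegInvGlue (b - u) := fun u => rfl
  have hχ0 : ∀ u, u ≤ a ∨ b ≤ u → χ u = 0 := by
    intro u hu
    rcases hu with h | h
    · rw [hχ_def, expNegInvGlue.zero_of_nonpos (by linarith), zero_mul]
    · rw [hχ_def, expNegInvGlue.zero_of_nonpos (by linarith : b - u ≤ 0), mul_zero]
  have hχinf : ContDiff ℝ ((⊤ : ℕ∞) : WithTop ℕ∞) χ :=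
    ((expNegInvGlue.contDiff (n := (⊤ : ℕ∞))).comp (contDiff_id.sub contDiff_const)).mul
      ((expNegInvGlue.contDiff (n := (⊤ : ℕ∞))).comp (contDiff_const.sub contDiff_id))
  have hχ2 : ContDiff ℝ 2 χ := contDiff_infty.1 hχinf 2
  have hnot : ∀ x, x ∉ Icc a b → x ≤ a ∨ b ≤ x := fun x hx => by
    by_contra hcon
    push Not at hcon
    exact hx ⟨hcon.1.le, hcon.2.le⟩
  -- bounded values
  obtain ⟨B₀, hB₀⟩ := Blindness.exists_abs_le_of_eq_zero_off hχ2.continuous (α := a) (β := b)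
    (fun x hx => hχ0 x (hnot x hx))
  -- bounded second derivative: `χ''` is continuous and vanishes off `[a, b]`
  have hd2 : ContDiff ℝ 2 (deriv (deriv χ)) := by
    have h := contDiff_infty.1 (hχinf.iterate_deriv 2) 2
    simpa [Function.iterate_succ, Function.comp] using h
  have hd2zero : ∀ x, x ∉ Icc a b → deriv (deriv χ) x = 0 := by
    intro x hx
    have hS : IsOpen (Icc a b)ᶜ := isClosed_Icc.isOpen_compl
    exact (deriv_deriv_eq_zero_of_eqOn_zero hS (fun u hu => hχ0 u (hnot u hu)) hx).2
  obtain ⟨B₂, hB₂⟩ := Blindness.exists_abs_le_of_eq_zero_off hd2.continuous hd2zero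
  refine ⟨χ, hχ2, hχ0, fun u hu => ?_, ⟨B₀, hB₀⟩, ⟨B₂, hB₂⟩⟩
  rw [hχ_def]
  exact mul_pos (expNegInvGlue.pos_of_pos (by linarith [hu.1]))
    (expNegInvGlue.pos_of_pos (by linarith [hu.2]))

/-! ### An integer in a multiplicative window -/

/-- For `B ≥ 2` there is `ℓ ≥ 1` with `B/3 ≤ ℓ(ℓ+1) ≤ B`. -/
theorem exists_nat_window {B : ℝ} (hB : 2 ≤ B) :
    ∃ ℓ : ℕ, 1 ≤ ℓ ∧ B / 3 ≤ (ℓ : ℝ) * ((ℓ : ℝ) + 1) ∧ (ℓ : ℝ) * ((ℓ : ℝ) + 1) ≤ B := by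
  have hex : ∃ n : ℕ, B < ((n : ℝ) + 1) * ((n : ℝ) + 2) := by
    obtain ⟨n, hn⟩ := exists_nat_gt B
    refine ⟨n, hn.trans_le ?_⟩
    have h0 : (0 : ℝ) ≤ n := Nat.cast_nonneg n
    nlinarith
  classical
  set n₀ := Nat.find hex with hn₀
  have hP : B < ((n₀ : ℝ) + 1) * ((n₀ : ℝ) + 2) := Nat.find_spec hex
  have hpos : 1 ≤ n₀ := by
    by_contra hcon
    push Not at hcon
    have : n₀ = 0 := by omega
    rw [this] at hP
    norm_num at hP
    linarith
  have hmin : ¬ B < ((((n₀ - 1 : ℕ) : ℝ)) + 1) * ((((n₀ - 1 : ℕ) : ℝ)) + 2) :=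
    Nat.find_min hex (show n₀ - 1 < n₀ by omega)
  push Not at hmin
  have hcast : (((n₀ - 1 : ℕ) : ℝ)) = (n₀ : ℝ) - 1 := by
    rw [Nat.cast_sub hpos]; simp
  rw [hcast] at hmin
  refine ⟨n₀, hpos, ?_, ?_⟩
  · have h1 : (1 : ℝ) ≤ n₀ := by exact_mod_cast hpos
    nlinarith
  · nlinarith

/-! ### `lintegral` bookkeeping for a continuous datum vanishing off `[α, β]` -/

/-- For a continuous `g` vanishing off `[α, β]` with `β < x_e`: the near velocity mass
`∫⁻_{x < x_e} g²` is finite and at least `∫_α^β g²`. -/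
theorem lintegral_sq_Iio {g : ℝ → ℝ} (hg : Continuous g) {α β xe : ℝ} (hαβ : α ≤ β) (hβ : β < xe)
    (h0 : ∀ x, (x ≤ α ∨ β ≤ x) → g x = 0) :
    (∫⁻ x in Iio xe, ENNReal.ofReal (g x ^ 2)) < ⊤ ∧
      ENNReal.ofReal (∫ x in α..β, g x ^ 2) ≤ ∫⁻ x in Iio xe, ENNReal.ofReal (g x ^ 2) := by
  have hc : Continuous fun x => g x ^ 2 := hg.pow 2
  have h0' : ∀ x, x ∉ Ioc (α - 1) β → ENNReal.ofReal (g x ^ 2) = 0 := by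
    intro x hx
    have : x ≤ α ∨ β ≤ x := by
      by_contra hcon
      push Not at hcon
      exact hx ⟨by linarith [hcon.1], hcon.2.le⟩
    rw [h0 x this]; simp
  constructor
  · calc (∫⁻ x in Iio xe, ENNReal.ofReal (g x ^ 2)) ≤ ∫⁻ x, ENNReal.ofReal (g x ^ 2) :=
          setLIntegral_le_lintegral _ _
      _ = ∫⁻ x in Ioc (α - 1) β, ENNReal.ofReal (g x ^ 2) := by
          rw [← lintegral_indicator measurableSet_Ioc]
          refine lintegral_congr fun x => ?_
          by_cases hx : x ∈ Ioc (α - 1) β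
          · rw [indicator_of_mem hx]
          · rw [indicator_of_notMem hx, h0' x hx]
      _ = ENNReal.ofReal (∫ x in (α - 1)..β, g x ^ 2) :=
          WaveEnergy.lintegral_Ioc_eq_ofReal_intervalIntegral hc (fun x => sq_nonneg _) (by linarith)
      _ < ⊤ := ENNReal.ofReal_lt_top
  · calc ENNReal.ofReal (∫ x in α..β, g x ^ 2) = ∫⁻ x in Ioc α β, ENNReal.ofReal (g x ^ 2) :=
          (WaveEnergy.lintegral_Ioc_eq_ofReal_intervalIntegral hc (fun x => sq_nonneg _) hαβ).symm
      _ ≤ ∫⁻ x in Iio xe, ENNReal.ofReal (g x ^ 2) :=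
          lintegral_mono_set fun x hx => lt_of_le_of_lt hx.2 hβ


/-- **Registered sub-goal `stub_restPacket_cutoff`** (item stmt-FinalStateConjecture-10045, prover
seat 1): `exists_cutoff` verbatim. -/
theorem stub_restPacket_cutoff :
    ∃ χ : ℝ → ℝ, ContDiff ℝ 2 χ ∧ (∀ u, u ≤ 13 / 20 ∨ 17 / 20 ≤ u → χ u = 0) ∧
      (∀ u ∈ Set.Ioo (13 / 20 : ℝ) (17 / 20), 0 < χ u) ∧
      (∃ B₀, ∀ u, |χ u| ≤ B₀) ∧ (∃ B₂, ∀ u, |deriv (deriv χ) u| ≤ B₂) :=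
  exists_cutoff

end Summit.FinalStateConjecture.FinalStateConjecture.Theorems.RestPacket

end
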